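import Mathlib
import Literature.Analysis.FluidPDE.NSUnconditionalUniquenessHolds
import Literature.Analysis.FluidPDE.CurlFreeLiouville
import Literature.Analysis.FluidPDE.ClassicalSolutionGlue
import Literature.Analysis.FluidPDE.NSQuasipotential
import Literature.Analysis.FluidPDE.TaoLocalisation
import Literature.Analysis.FluidPDE.LerayHopf
import Literature.Analysis.FluidPDE.NSWave0
import HarnessLib

/-!
# Route `TautLoopKelvin`, crux `TautLoopLaw` (stmt-NavierStokesRegularity-15249), line
  `Sketch-ideas-r1k1` (Dini–Saks architecture) — tools stub `stub_tautLoopStepIrrotationalRestTools`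

**Statement (an irrotational slice is at rest, and rest persists).** Let `ν, T > 0` and let
`(u, p)` be a classical solution of the unforced Navier–Stokes system on `[0, T) × ℝ³` which is a
Leray–Hopf solution on `[0, T)` from its (rapidly decaying) datum `u 0`. If the vorticity of some
slice vanishes identically, `curl (u s) ≡ 0` with `0 ≤ s < T`, then `u t' ≡ 0` for every
`t' ∈ [s, T)`.

**Proof.**

1. *Liouville.* The slice `u s` is smooth (`IsClassicalNSSolutionOn.contDiff_velocity`),
   divergence free (`IsClassicalNSSolutionOn.divFree`) and curl free, hence (vector-)harmonic
   (`laplacian_eq_zero_of_curl_eq_zero_of_isDivFree`: `Δ = ∇ div − curl curl` for `C²` fields),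
   and square integrable (`IsLerayHopfOn.memLp`). A harmonic map on `ℝ³` lying in `L²` vanishes
   (Liouville's theorem in `L^q`, `eq_zero_of_harmonic_memLp_inner`: mean value property and
   Hölder on large balls). So `u s = 0`.
2. *Rest persists.* For `s < t' < T` put `T₁ = t' − s > 0`. The time-shifted pair
   `(u (· + s), p (· + s))` is a classical solution on `[0, T − s)`
   (`IsClassicalNSSolutionOn.translate_Ico_zero`; the system is autonomous), hence on the closed
   slab `[0, T₁] ⊆ [0, T − s)` (`IsClassicalNSSolutionOn.mono`), with finite energy
   `∫ ‖u (t + s)‖² ≤ 2 E(u 0)` (Leray–Hopf energy inequality, `IsLerayHopfOn.lintegral_enorm_sq_le`)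
   and datum `u s = 0`. The rest state `(0, 0)` is a classical finite-energy solution on the same
   slab (`isClassicalNSSolutionOn_zero`) with the same `H¹` datum `0`. By Tao's unconditional
   uniqueness of finite-energy smooth solutions from `H¹` data (Tao 2013, Cor. 11.4, velocity
   form; in-tree theorem `tao_unconditional_uniqueness_velocity_holds`) the two velocities agree on
   `[0, T₁]`; at time `T₁` this reads `u t' = 0`. The case `t' = s` is step 1.

The rapid decay of the datum and `0 < T` are not needed for this argument (they are part of the
crux class and kept in the registered signature).
-/

noncomputable section

open Set MeasureTheory Filter Topology Function InnerProductSpace Literature.Analysis.FluidPDE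
open scoped ENNReal NNReal ContDiff

namespace Summit.NavierStokesRegularity.NavierStokesRegularity.Theorems

set_option linter.dupNamespace false

/-! ## Step 1: an irrotational slice of the class vanishes (Liouville in `L²`) -/

/-- **Liouville step.** For a classical solution on `[0, T)` which is Leray–Hopf on `[0, T)`, a
slice `u s`, `s ∈ [0, T)`, with `curl (u s) ≡ 0` vanishes identically: it is `C²`, divergence
free and curl free, hence harmonic (`Δ = ∇ div − curl curl`), and it lies in `L²`; a harmonic
`L²` map on `ℝ³` is zero (mean value property + Hölder on balls of radius `R → ∞`). [folklore] -/
theorem tautLoopIrrot_slice_eq_zero {ν T : ℝ}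
    {u : ℝ → EuclideanSpace ℝ (Fin 3) → EuclideanSpace ℝ (Fin 3)}
    {p : ℝ → EuclideanSpace ℝ (Fin 3) → ℝ} (hcl : IsClassicalNSSolutionOn (Ico 0 T) ν 0 u p)
    (hLH : IsLerayHopfOn T ν 0 (u 0) u) {s : ℝ} (hs : s ∈ Ico 0 T)
    (hcurl : ∀ x, curl (u s) x = 0) : u s = 0 := by
  have h2 : ContDiff ℝ 2 (u s) := (hcl.contDiff_velocity hs).of_le (by norm_cast)
  have hΔ := laplacian_eq_zero_of_curl_eq_zero_of_isDivFree h2 hcurl (hcl.divFree s hs)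
  exact eq_zero_of_harmonic_memLp_inner (harmonicOnNhd_of_laplacian_eq_zero h2 hΔ)
    (by norm_num) (by norm_num) (hLH.memLp s ⟨hs.1, hs.2.le⟩)

/-! ## Step 2: rest persists (uniqueness in Tao's finite-energy smooth class) -/

/-- **Rest persists.** If a classical solution on `[0, T)`, Leray–Hopf on `[0, T)`, has a
vanishing slice `u s = 0`, `0 ≤ s`, then `u t' = 0` for every `t' ∈ (s, T)`: the time-shifted
solution `u (· + s)` and the rest state `0` are two classical finite-energy solutions on the
closed slab `[0, t' − s]` with the same `H¹` datum `0`, so they coincide by Tao's unconditional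
uniqueness (Tao 2013, Cor. 11.4, velocity form; `tao_unconditional_uniqueness_velocity_holds`).
[folklore] -/
theorem tautLoopIrrot_rest_persists {ν T : ℝ} (hν : 0 < ν)
    {u : ℝ → EuclideanSpace ℝ (Fin 3) → EuclideanSpace ℝ (Fin 3)}
    {p : ℝ → EuclideanSpace ℝ (Fin 3) → ℝ} (hcl : IsClassicalNSSolutionOn (Ico 0 T) ν 0 u p)
    (hLH : IsLerayHopfOn T ν 0 (u 0) u) {s t' : ℝ} (hs : 0 ≤ s) (hst' : s < t') (ht'T : t' < T)
    (hus : u s = 0) : u t' = 0 := by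
  have hT₁ : 0 < t' - s := sub_pos.2 hst'
  -- the shifted solution on the closed slab `[0, t' - s]`
  have hv : IsClassicalNSSolutionOn (Icc 0 (t' - s)) ν 0 (fun t => u (t + s))
      (fun t => p (t + s)) :=
    (hcl.translate_Ico_zero hs).mono (Icc_subset_Ico_right (by linarith)) (uniqueDiffOn_Icc hT₁)
  -- the rest state on the same slab
  have h0 : IsClassicalNSSolutionOn (Icc 0 (t' - s)) ν
      (0 : ℝ → EuclideanSpace ℝ (Fin 3) → EuclideanSpace ℝ (Fin 3)) 0 0 :=
    isClassicalNSSolutionOn_zero _ _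
  -- finite energy of both
  have hEv : ∃ C : ℝ≥0∞, C < ⊤ ∧ ∀ t ∈ Icc 0 (t' - s),
      ∫⁻ x, ‖u (t + s) x‖ₑ ^ 2 ≤ C :=
    ⟨ENNReal.ofReal (2 * VectorCalculus.kineticEnergy (u 0)), ENNReal.ofReal_lt_top,
      fun t ht => hLH.lintegral_enorm_sq_le hν.le ⟨by linarith [ht.1], by linarith [ht.2]⟩⟩
  have hE0 : ∃ C : ℝ≥0∞, C < ⊤ ∧ ∀ t ∈ Icc 0 (t' - s),
      ∫⁻ x, ‖(0 : ℝ → EuclideanSpace ℝ (Fin 3) → EuclideanSpace ℝ (Fin 3)) t x‖ₑ ^ 2 ≤ C :=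
    ⟨0, ENNReal.zero_lt_top, fun t _ => by simp⟩
  -- the common `H¹` datum `0`
  have hdat : MemLp (0 : EuclideanSpace ℝ (Fin 3) → EuclideanSpace ℝ (Fin 3)) 2 volume :=
    MemLp.zero
  have hdat' : MemLp (fderiv ℝ (0 : EuclideanSpace ℝ (Fin 3) → EuclideanSpace ℝ (Fin 3))) 2
      volume := by
    rw [fderiv_zero]
    exact MemLp.zero (ε := EuclideanSpace ℝ (Fin 3) →L[ℝ] EuclideanSpace ℝ (Fin 3))
  have hv0 : (fun t => u (t + s)) 0 = 0 := by simp [hus]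
  have key := tao_unconditional_uniqueness_velocity_holds ν (t' - s) hν hT₁ 0 hdat hdat'
    (fun t => u (t + s)) 0 (fun t => p (t + s)) 0 hv h0 hv0 rfl hEv hE0 (t' - s)
    ⟨hT₁.le, le_rfl⟩
  simpa [sub_add_cancel] using key

/-! ## The registered tools stub -/

/-- **Tools stub `stub_tautLoopStepIrrotationalRestTools`** (registered signature, verbatim): for
a classical solution of the unforced Navier–Stokes system on `[0, T) × ℝ³`, Leray–Hopf from its
rapidly decaying datum, if `curl (u s) ≡ 0` for some `s ∈ [0, T)` then `u t' ≡ 0` for every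
`t' ∈ [s, T)` (Liouville for divergence-free curl-free `L²` fields, then Tao's unconditional
uniqueness against the rest state for the time-shifted solution). [folklore] -/
theorem stub_tautLoopStepIrrotationalRestTools : ∀ (ν T : ℝ), 0 < ν → 0 < T →
    ∀ (u : ℝ → EuclideanSpace ℝ (Fin 3) → EuclideanSpace ℝ (Fin 3))
      (p : ℝ → EuclideanSpace ℝ (Fin 3) → ℝ),
      Literature.Analysis.FluidPDE.IsClassicalNSSolutionOn (Set.Ico 0 T) ν 0 u p →
      Literature.Analysis.FluidPDE.IsLerayHopfOn T ν 0 (u 0) u →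
      Literature.Analysis.FluidPDE.HasRapidSpatialDecay (u 0) →
      ∀ s t' : ℝ, 0 ≤ s → s ≤ t' → t' < T →
        (∀ x, Literature.Analysis.FluidPDE.curl (u s) x = 0) → ∀ x, u t' x = 0 := by
  intro ν T hν _hT u p hcl hLH _hdec s t' hs hst' ht'T hcurl x
  have hus : u s = 0 := tautLoopIrrot_slice_eq_zero hcl hLH ⟨hs, hst'.trans_lt ht'T⟩ hcurl
  rcases hst'.eq_or_lt with h | h
  · subst h
    simp [hus]
  · simp [tautLoopIrrot_rest_persists hν hcl hLH hs h ht'T hus]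

end Summit.NavierStokesRegularity.NavierStokesRegularity.Theorems

end
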